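import Literature.LinearAlgebra.QuadraticForm.PosComplexStructuresPolarizationKernelSections
import Literature.Topology.CoveringSpaces.AssociatedCoveringSubsystems
import HarnessLib

/-!
# The short exact sequence of local systems `0 → R₁ —λ_ψ→ R¹ → 𝒦 → 0` of Deligne's family: the image
# `λ_ψ(R₁) ⊂ R¹` is a clopen sub-local-system (the classes of `λ_ψ V(ℤ)`), EXACTNESS at `R¹` against the
# zero section of the kernel system `𝒦 = Γ\(X⁺ × K(ψ))`, and `𝒦 = R¹/λ_ψ(R₁)` as a quotient space

Topic `LinearAlgebra/QuadraticForm`; sequel of `QuadraticForm/PosComplexStructuresPolarizationKernelLocalSystem`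
(`R₁ = LatticeSystem k ψ Λ G = Γ\(X⁺ × V(ℤ))`, `R¹ = DualLatticeSystem G = Γ\(X⁺ × V(ℤ)^∨)`, the
polarization morphism `polarizationLatticeMap : R₁ → R¹`, `[(J, v)] ↦ [(J, ψ(v, ·))]` (injective,
continuous), the quotient morphism `dualLatticeToKernel : R¹ → 𝒦` (continuous, surjective) and
`dualLatticeToKernel_polarizationLatticeMap` (the composite is the zero section on classes);
`dualRep_mem_range_psiLattice`), `QuadraticForm/PosComplexStructuresPolarizationKernelSections` (the zero
section `kernelZeroSection`) and the generic `Topology/CoveringSpaces/AssociatedCoveringSubsystems`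
(`subInclusion`, `isClopen_range_subInclusion`: sub-`G`-sets give clopen sub-local-systems) and
`AssociatedCovering` (`isOpenMap_assocMk`).

SOURCES (held, read at the page; VERBATIM). H. Lange, *Abelian Varieties over the Complex Numbers*
[Lange2023AbelianVarietiesComplex] §1.4.2 (held text p0044–p0045): «Lemma 1.4.5 The analytic representation
of `φ_L : X → X̂` is `φ_H : V → Ω̄, v ↦ H(v, ·)`», «`Λ(L) = φ_H⁻¹(Λ̂)`, which implies `K(L) = Λ(L)/Λ`
(1.14)» — on the lattices: `0 → Λ —φ_H→ Λ̂ → Λ̂/φ_H(Λ) → 0` with `Λ̂ = Hom(Λ, ℤ) = V(ℤ)^∨`,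
`φ_H|_Λ = λ_ψ`. P. Deligne (notes by J. S. Milne), *Hodge cycles on abelian varieties*, LNM 900
[Deligne1982HodgeCycles], proof of Thm. 4.8, p. 50 (held p0034): «`Θ₁` the polarization with Riemann form
`ψ`», «`Γ` acts on `X⁺` … and (compatibly) on `B`». C. Voisin [VoisinHodgeII2003] §3.1.1 (3.1), Cor. 3.10
(held p0088–p0090): sub-local-systems ↔ `π₁`-stable subsets of the fibre. A. Hatcher [HatcherAT2002]
§1.3 p. 70 (maps of covering spaces induced by `π₁`-maps of fibres). J. P. May [MayConcise1999] Ch. 3 §7.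

## What is formalised (`Γ(1) = arithmeticGroup k ψ Λ`, `G ≤ Γ(1)`; `hψΛ : ψ(V(ℤ), V(ℤ)) ⊆ ℤ`; torsion-free
## `G` (`htf`) for the statements over `Γ\X⁺`)

* §1 ★ `rangePsiLatticeSub G hψΛ` — **`λ_ψ V(ℤ) ⊂ V(ℤ)^∨` as a sub-`Γ`-set** (`SubMulAction`, by
  `dualRep_mem_range_psiLattice`); ★ `dualLatticeSystemMk_mem_range_polarizationLatticeMap_iff` —
  **`[(J, f)] ∈ λ_ψ(R₁)` iff `f ∈ λ_ψ V(ℤ)`**; `range_polarizationLatticeMap_eq_range_subInclusion`;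
  ★★ `isClopen_range_polarizationLatticeMap` — **the image `λ_ψ(R₁) ⊂ R¹` is a clopen sub-local-system**.
* §2 ★★ `dualLatticeToKernel_eq_kernelZeroSection_iff` — **EXACTNESS AT `R¹`: a point of `R¹` maps to the
  zero section of `𝒦` iff it lies in `λ_ψ(R₁)`**; `range_polarizationLatticeMap_eq_preimage` (the image is
  the preimage of the zero section).
* §3 `isOpenMap_mapFibre_of_discreteTopology` (maps of associated coverings with discrete fibres are open),
  ★ `isOpenMap_dualLatticeToKernel`, ★★ `isQuotientMap_dualLatticeToKernel` — **`𝒦 = R¹/λ_ψ(R₁)` is the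
  quotient of `R¹`** (continuous open surjection), and `isOpenMap_polarizationLatticeMap`,
  `isOpenEmbedding_polarizationLatticeMap` — **`R₁ ↪ R¹` is an open embedding onto `λ_ψ(R₁)`**.

Definitions with bodies, theorems; no `sorry`; no named facts; no instances (`letI`); no notation.

## References

* [Lange2023AbelianVarietiesComplex] H. Lange, *Abelian Varieties over the Complex Numbers*, Springer 2023,
  §1.4.2 Lemma 1.4.5, (1.14).
* [Deligne1982HodgeCycles] P. Deligne, *Hodge cycles on abelian varieties*, in LNM 900, Springer 1982,
  proof of Thm. 4.8, p. 50.
* [VoisinHodgeII2003] C. Voisin, *Hodge Theory and Complex Algebraic Geometry II*, CUP 2003, §3.1.1.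
* [HatcherAT2002] A. Hatcher, *Algebraic Topology*, CUP 2002, §1.3 p. 70.
* [MayConcise1999] J. P. May, *A Concise Course in Algebraic Topology*, 1999, Ch. 3 §7.
-/

noncomputable section

open MulAction Function Set Topology
open Literature.Topology.CoveringSpaces Literature.Topology.CoveringSpaces.AssocCovering

namespace Literature.LinearAlgebra.QuadraticForm

namespace arithmeticGroup

variable {V : Type*} [NormedAddCommGroup V] [NormedSpace ℝ V]
variable {k : V →L[ℝ] V} {ψ : LinearMap.BilinForm ℝ V} {Λ : Submodule ℤ V}
variable (G : Subgroup (arithmeticGroup k ψ Λ))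

/-! ### §1 The image `λ_ψ(R₁) ⊂ R¹`: a clopen sub-local-system -/

/-- ★ **`λ_ψ V(ℤ) ⊂ V(ℤ)^∨` is a sub-`Γ`-set** for the contragredient action (`ρ^∨(γ)(ψ(x, ·)) = ψ(γx, ·)`).
[cite: Lange2023AbelianVarietiesComplex, §1.4.2 Lemma 1.4.5] [cite: Deligne1982HodgeCycles, proof of Thm. 4.8, p. 50] -/
def rangePsiLatticeSub (hψΛ : ∀ x ∈ Λ, ∀ y ∈ Λ, ∃ m : ℤ, ψ x y = m) :
    letI := dualAction k ψ Λ
    SubMulAction G (Module.Dual ℤ Λ) :=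
  letI := dualAction k ψ Λ
  { carrier := LinearMap.range (psiLattice hψΛ)
    smul_mem' := fun γ _ hf ↦ dualRep_mem_range_psiLattice hψΛ (γ : arithmeticGroup k ψ Λ) hf }

/-- Membership: `f ∈ λ_ψ V(ℤ)`. [cite: Lange2023AbelianVarietiesComplex, §1.4.2 Lemma 1.4.5] -/
theorem mem_rangePsiLatticeSub_iff (hψΛ : ∀ x ∈ Λ, ∀ y ∈ Λ, ∃ m : ℤ, ψ x y = m) (f : Module.Dual ℤ Λ) :
    (letI := dualAction k ψ Λ; f ∈ rangePsiLatticeSub G hψΛ) ↔ f ∈ LinearMap.range (psiLattice hψΛ) :=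
  Iff.rfl

/-- ★ **`[(J, f)] ∈ λ_ψ(R₁)` iff `f ∈ λ_ψ V(ℤ)`** (independent of the representative: `λ_ψ V(ℤ)` is
`Γ`-stable). [cite: Lange2023AbelianVarietiesComplex, §1.4.2 (1.14)] [cite: VoisinHodgeII2003, §3.1.1 (3.1)] -/
theorem dualLatticeSystemMk_mem_range_polarizationLatticeMap_iff
    (hψΛ : ∀ x ∈ Λ, ∀ y ∈ Λ, ∃ m : ℤ, ψ x y = m) (J : posComplexStructures k ψ) (f : Module.Dual ℤ Λ) :
    dualLatticeSystemMk G (J, f) ∈ range (polarizationLatticeMap G hψΛ) ↔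
      f ∈ LinearMap.range (psiLattice hψΛ) := by
  constructor
  · rintro ⟨q, hq⟩
    obtain ⟨⟨J', v⟩, rfl⟩ := surjective_latticeSystemMk (G := G) q
    rw [polarizationLatticeMap_mk, dualLatticeSystemMk_eq_iff] at hq
    obtain ⟨γ, -, hγ⟩ := hq
    have hf : dualRep k ψ Λ ((γ⁻¹ : G) : arithmeticGroup k ψ Λ) (psiLattice hψΛ v) = f := by
      rw [← hγ, ← Module.End.mul_apply, ← map_mul, Subgroup.coe_inv, inv_mul_cancel, map_one,
        Module.End.one_apply]
    rw [← hf]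
    exact dualRep_mem_range_psiLattice hψΛ _ ⟨v, rfl⟩
  · rintro ⟨v, rfl⟩
    exact ⟨latticeSystemMk k ψ Λ G (J, v), polarizationLatticeMap_mk G hψΛ J v⟩

/-- **The image `λ_ψ(R₁)` is the sub-local-system of the sub-`Γ`-set `λ_ψ V(ℤ)`.**
[cite: VoisinHodgeII2003, §3.1.1 Cor. 3.10, (3.1)] [cite: MayConcise1999, Ch. 3 §7] -/
theorem range_polarizationLatticeMap_eq_range_subInclusion (hψΛ : ∀ x ∈ Λ, ∀ y ∈ Λ, ∃ m : ℤ, ψ x y = m) :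
    range (polarizationLatticeMap G hψΛ) =
      (letI := dualAction k ψ Λ
       range (subInclusion (E := posComplexStructures k ψ) G (rangePsiLatticeSub G hψΛ))) := by
  letI := dualAction k ψ Λ
  ext q
  obtain ⟨⟨J, f⟩, rfl⟩ := surjective_dualLatticeSystemMk G q
  rw [dualLatticeSystemMk_mem_range_polarizationLatticeMap_iff]
  exact (assocMk_mem_range_subInclusion_iff (E := posComplexStructures k ψ) (rangePsiLatticeSub G hψΛ) J f).symm

section TorsionFree

variable {G}
variable [FiniteDimensional ℝ V] [DiscreteTopology Λ] [IsZLattice ℝ Λ]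
  (htf : ∀ g : G, IsOfFinOrder g → g = 1)

include htf in
/-- ★★ **The image `λ_ψ(R₁) ⊂ R¹ = Γ\(X⁺ × V(ℤ)^∨)` is CLOPEN — a sub-local-system of `R¹` over `Γ\X⁺`**
(torsion-free `Γ`). [cite: VoisinHodgeII2003, §3.1.1 Cor. 3.10, (3.1)] [cite: HatcherAT2002, §1.3 p. 70]
[cite: Deligne1982HodgeCycles, proof of Thm. 4.8, p. 50] -/
theorem isClopen_range_polarizationLatticeMap (hψΛ : ∀ x ∈ Λ, ∀ y ∈ Λ, ∃ m : ℤ, ψ x y = m) :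
    letI : TopologicalSpace (Module.Dual ℤ Λ) := ⊥
    IsClopen (range (polarizationLatticeMap G hψΛ)) := by
  letI : TopologicalSpace (Module.Dual ℤ Λ) := ⊥
  haveI : DiscreteTopology (Module.Dual ℤ Λ) := ⟨rfl⟩
  letI := dualAction k ψ Λ
  rw [range_polarizationLatticeMap_eq_range_subInclusion]
  exact isClopen_range_subInclusion (isQuotientCoveringMap_of_torsionFree G htf) _

/-! ### §2 Exactness at `R¹`: `λ_ψ(R₁)` is the preimage of the zero section of `𝒦` -/

/-- ★★ **EXACTNESS of `0 → R₁ → R¹ → 𝒦 → 0` at `R¹`: a point `q ∈ R¹` over `x ∈ Γ\X⁺` maps to the zero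
`0_x` of the kernel system iff `q ∈ λ_ψ(R₁)`** («`Λ(L) = φ_H⁻¹(Λ̂)` … `K(L) = Λ(L)/Λ`»: on `V(ℤ)^∨` the
kernel of `V(ℤ)^∨ → K(ψ)` is `λ_ψ V(ℤ)`). [cite: Lange2023AbelianVarietiesComplex, §1.4.2 (1.14)]
[cite: VoisinHodgeII2003, §3.1.1 (3.1)] -/
theorem dualLatticeToKernel_eq_kernelZeroSection_iff (hψΛ : ∀ x ∈ Λ, ∀ y ∈ Λ, ∃ m : ℤ, ψ x y = m)
    (q : DualLatticeSystem G) :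
    dualLatticeToKernel G hψΛ q = kernelZeroSection htf hψΛ (dualLatticeSystemProj htf q) ↔
      q ∈ range (polarizationLatticeMap G hψΛ) := by
  obtain ⟨⟨J, f⟩, rfl⟩ := surjective_dualLatticeSystemMk G q
  rw [dualLatticeToKernel_mk, dualLatticeSystemProj_mk, kernelZeroSection_mk,
    dualLatticeSystemMk_mem_range_polarizationLatticeMap_iff]
  letI := cokernelAction k ψ Λ hψΛ
  rw [show polarizationKernelSystemMk G hψΛ (J, Submodule.Quotient.mk f) =
      polarizationKernelSystemMk G hψΛ (J, 0) ↔ _ from assocMk_eq_iff]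
  constructor
  · rintro ⟨γ, -, hγ⟩
    have h0 : (Submodule.Quotient.mk f : Module.Dual ℤ Λ ⧸ LinearMap.range (psiLattice hψΛ)) = 0 := by
      rw [← hγ]
      exact map_zero (cokernelMap hψΛ (γ : arithmeticGroup k ψ Λ))
    exact (Submodule.Quotient.mk_eq_zero _).1 h0
  · intro hf
    exact ⟨1, one_smul _ _, by rw [(Submodule.Quotient.mk_eq_zero _).2 hf]; exact one_smul _ _⟩

/-- The same, as an equality of sets: **`λ_ψ(R₁)` is the preimage of the zero section of `𝒦`.**
[cite: Lange2023AbelianVarietiesComplex, §1.4.2 (1.14)] -/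
theorem range_polarizationLatticeMap_eq_preimage (hψΛ : ∀ x ∈ Λ, ∀ y ∈ Λ, ∃ m : ℤ, ψ x y = m) :
    range (polarizationLatticeMap G hψΛ) =
      {q | dualLatticeToKernel G hψΛ q = kernelZeroSection htf hψΛ (dualLatticeSystemProj htf q)} := by
  ext q
  exact (dualLatticeToKernel_eq_kernelZeroSection_iff htf hψΛ q).symm

end TorsionFree

/-! ### §3 `𝒦 = R¹/λ_ψ(R₁)`: the quotient morphism is an open quotient map -/

/-- **Maps of associated coverings with discrete fibres are open**: for `G`-sets `S`, `S'` (discrete) and a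
`G`-map `h : S → S'`, `[(e, s)] ↦ [(e, h s)]` is an open map `E ×_G S → E ×_G S'` (`G` acting on `E` by
homeomorphisms). [cite: HatcherAT2002, §1.3 p. 70] [cite: MayConcise1999, Ch. 3 §7] -/
theorem isOpenMap_mapFibre_of_discreteTopology {Γ₀ E S S' : Type*} [Group Γ₀] [MulAction Γ₀ E]
    [MulAction Γ₀ S] [MulAction Γ₀ S'] [TopologicalSpace E] [ContinuousConstSMul Γ₀ E]
    [TopologicalSpace S] [DiscreteTopology S] [TopologicalSpace S'] [DiscreteTopology S']
    (h : S → S') (hh : ∀ (g : Γ₀) (s : S), h (g • s) = g • h s) :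
    IsOpenMap (mapFibre (E := E) h hh) := by
  intro U hU
  have hU' : IsOpen ((assocMk : E × S → AssocSpace Γ₀ E S) ⁻¹' U) := hU.preimage continuous_assocMk
  -- the image is `assocMk` of the image of the preimage under `id × h`
  have himage : mapFibre (E := E) h hh '' U =
      (assocMk : E × S' → AssocSpace Γ₀ E S') ''
        (Prod.map id h '' ((assocMk : E × S → AssocSpace Γ₀ E S) ⁻¹' U)) := by
    ext q
    constructor
    · rintro ⟨p, hp, rfl⟩
      obtain ⟨⟨e, s⟩, rfl⟩ := surjective_assocMk p
      exact ⟨(e, h s), ⟨(e, s), hp, rfl⟩, rfl⟩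
    · rintro ⟨_, ⟨⟨e, s⟩, hp, rfl⟩, rfl⟩
      exact ⟨assocMk (e, s), hp, rfl⟩
  rw [himage]
  refine isOpenMap_assocMk _ ?_
  -- `id × h` of an open set of `E × S` is open in `E × S'` (discrete factors)
  have hdecomp : Prod.map id h '' ((assocMk : E × S → AssocSpace Γ₀ E S) ⁻¹' U) =
      ⋃ s : S, {e : E | (e, s) ∈ (assocMk : E × S → AssocSpace Γ₀ E S) ⁻¹' U} ×ˢ {h s} := by
    ext ⟨e, s'⟩
    simp only [mem_image, mem_iUnion, mem_prod, mem_setOf_eq, mem_singleton_iff, Prod.exists,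
      Prod.map_apply, id_eq, Prod.mk.injEq]
    constructor
    · rintro ⟨e₀, s, hp, rfl, rfl⟩
      exact ⟨s, hp, rfl⟩
    · rintro ⟨s, hp, rfl⟩
      exact ⟨e, s, hp, rfl, rfl⟩
  rw [hdecomp]
  refine isOpen_iUnion fun s ↦ IsOpen.prod ?_ (isOpen_discrete _)
  exact hU'.preimage (Continuous.prodMk_left s)

section Quotient

/-- ★ **The quotient morphism `R¹ → 𝒦` is an open map.** [cite: HatcherAT2002, §1.3 p. 70] -/
theorem isOpenMap_dualLatticeToKernel (hψΛ : ∀ x ∈ Λ, ∀ y ∈ Λ, ∃ m : ℤ, ψ x y = m) :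
    letI : TopologicalSpace (Module.Dual ℤ Λ) := ⊥
    letI : TopologicalSpace (Module.Dual ℤ Λ ⧸ LinearMap.range (psiLattice hψΛ)) := ⊥
    IsOpenMap (dualLatticeToKernel G hψΛ) := by
  letI : TopologicalSpace (Module.Dual ℤ Λ) := ⊥
  haveI : DiscreteTopology (Module.Dual ℤ Λ) := ⟨rfl⟩
  letI : TopologicalSpace (Module.Dual ℤ Λ ⧸ LinearMap.range (psiLattice hψΛ)) := ⊥
  haveI : DiscreteTopology (Module.Dual ℤ Λ ⧸ LinearMap.range (psiLattice hψΛ)) := ⟨rfl⟩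
  letI := dualAction k ψ Λ
  letI := cokernelAction k ψ Λ hψΛ
  exact isOpenMap_mapFibre_of_discreteTopology (Γ₀ := G) (E := posComplexStructures k ψ) _ _

/-- ★★ **`𝒦 = R¹/λ_ψ(R₁)`: the quotient morphism `R¹ → 𝒦` is a topological quotient map** (continuous,
open, surjective) — the kernel system is the quotient local system of `R¹` by the image of `R₁`.
[cite: Lange2023AbelianVarietiesComplex, §1.4.2 (1.14)] [cite: HatcherAT2002, §1.3 p. 70] -/
theorem isQuotientMap_dualLatticeToKernel (hψΛ : ∀ x ∈ Λ, ∀ y ∈ Λ, ∃ m : ℤ, ψ x y = m) :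
    letI : TopologicalSpace (Module.Dual ℤ Λ) := ⊥
    letI : TopologicalSpace (Module.Dual ℤ Λ ⧸ LinearMap.range (psiLattice hψΛ)) := ⊥
    IsQuotientMap (dualLatticeToKernel G hψΛ) := by
  letI : TopologicalSpace (Module.Dual ℤ Λ) := ⊥
  letI : TopologicalSpace (Module.Dual ℤ Λ ⧸ LinearMap.range (psiLattice hψΛ)) := ⊥
  exact (isOpenMap_dualLatticeToKernel G hψΛ).isQuotientMap
    (continuous_surjective_dualLatticeToKernel G hψΛ).1 (continuous_surjective_dualLatticeToKernel G hψΛ).2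

/-- ★ **The polarization morphism `R₁ → R¹` is an open map.** [cite: HatcherAT2002, §1.3 p. 70] -/
theorem isOpenMap_polarizationLatticeMap [DiscreteTopology Λ] (hψΛ : ∀ x ∈ Λ, ∀ y ∈ Λ, ∃ m : ℤ, ψ x y = m) :
    letI : TopologicalSpace (Module.Dual ℤ Λ) := ⊥
    IsOpenMap (polarizationLatticeMap G hψΛ) := by
  letI : TopologicalSpace (Module.Dual ℤ Λ) := ⊥
  haveI : DiscreteTopology (Module.Dual ℤ Λ) := ⟨rfl⟩
  letI := latticeAction k ψ Λ
  letI := dualAction k ψ Λ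
  exact isOpenMap_mapFibre_of_discreteTopology (Γ₀ := G) (E := posComplexStructures k ψ) _ _

/-- ★ **`R₁ ↪ R¹` is an open embedding onto `λ_ψ(R₁)`** for non-degenerate `ψ` (injective, continuous,
open). [cite: Lange2023AbelianVarietiesComplex, §1.4.2 Lemma 1.4.5] [cite: HatcherAT2002, §1.3 p. 70] -/
theorem isOpenEmbedding_polarizationLatticeMap [DiscreteTopology Λ] [IsZLattice ℝ Λ] (hnd : ψ.Nondegenerate)
    (hψΛ : ∀ x ∈ Λ, ∀ y ∈ Λ, ∃ m : ℤ, ψ x y = m) :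
    letI : TopologicalSpace (Module.Dual ℤ Λ) := ⊥
    IsOpenEmbedding (polarizationLatticeMap G hψΛ) := by
  letI : TopologicalSpace (Module.Dual ℤ Λ) := ⊥
  exact IsOpenEmbedding.of_continuous_injective_isOpenMap (continuous_polarizationLatticeMap G hψΛ)
    (injective_polarizationLatticeMap hnd hψΛ) (isOpenMap_polarizationLatticeMap G hψΛ)

end Quotient

end arithmeticGroup

end Literature.LinearAlgebra.QuadraticForm
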